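import Mathlib
import HarnessLib
import Literature.AlgebraicGeometry.Ramification.InertiaNormalSylow
import Literature.AlgebraicGeometry.Resolution.BlowupsEquivariant

/-!
# Kollár–Szabó going down, blow-up step (K2-scheme, abstract half): equivariance of lifts to a blow-up and
# inertia at the image of a fixed field-valued point (crux `WildQuotients.WildQuotientResolution`,
# stub `stub_phaseZeroHighDim`)

Crux stmt-ResolutionOfSingularities-15640 (`WildQuotientResolution`), registered stub `stub_phaseZeroHighDim`;
programme PHASE0-KS-EIGENLINE (hands 8-g0/8-g1/9-g0), target: the abstract blow-up step `hstep` of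
✓`KSGoingDown.goingDown_of_step` / ✓`kollarSzaboGoingDown_of_step`, whose remaining geometric input is an
`H`-FIXED closed point `x'` (with INERTIA, `h ∈ I_{x'}` in the `fromSpecResidueField` sense of
`Literature.AlgebraicGeometry.Ramification.inertiaSubgroup`) on the point blow-up `X' = Bl_x X` for the lifted
action (✓`IsBlowup.liftAction`). This file isolates the scheme-theoretic mechanism, which needs NO separatedness
and NO identification of local rings: the UNIVERSAL PROPERTY of blowing up (✓`IsBlowup.hom_ext`).

* `comp_eq_comp_of_isBlowup` — **lifts are equivariant**: let `π : X' → X` be a blowing up along `I`,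
  `s : X → X` with `s⁻¹ I = I` and `s' : X' → X'` over it (`s' ≫ π = π ≫ s`); if `φ : T → X'` pulls the centre
  back to an effective Cartier divisor and `a : T → T` lies over `s` through `φ ≫ π`
  (`a ≫ φ ≫ π = φ ≫ π ≫ s`), then `a ≫ φ = φ ≫ s'` (both are lifts of the same morphism `T → X`);
* `mem_inertiaSubgroup_of_fixed_fieldPoint` — hence, for an action `σ'` on `X'` over an action `σ` on `X`
  preserving `I`, and a field-valued point `p : Spec K → T` FIXED by endomorphisms `a_g` of `T` over `σ_g`
  (`p ≫ a_g = p`), every `g` lies in the inertia group of `σ'` at the point `(p ≫ φ)(closed point)`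
  (✓`mem_inertiaSubgroup_iff_comp_eq`: `I_y` is the stabiliser of any field-valued point localised at `y`);
* `mem_inertiaSubgroup_liftAction_of_fixed_fieldPoint` — the same for the lifted action
  ✓`IsBlowup.liftAction`.

Use (next files of the programme): `T = Spec R₁` for the `σ`-stable quadratic transform `R₁ = S[𝔪/t]_𝔫` of
✓`EigenlineChart.exists_equivariant_quadraticTransform` (hand 8-g1), `φ` the lift of
`Spec R₁ → Spec 𝒪_{X,x} → X`, `a_g = Spec` of the restricted automorphism, `p` the closed point (fixed because
the restricted action is residue-trivial): the image of `p` is the Kollár–Szabó fixed point `[W]` of the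
exceptional divisor.

[OURS · crux stmt-ResolutionOfSingularities-15640 · helper toward `stub_phaseZeroHighDim` (mechanism of the
fixed point in the abstract blow-up step of Kollár–Szabó going down; NOT a proof of the stub); folklore,
counted 0; AI-level work, weaker than expert review.] [folklore]
-/

-- single-problem summit: the doubled namespace component `ResolutionOfSingularities` is forced
set_option linter.dupNamespace false

noncomputable section

open CategoryTheory CategoryTheory.Limits AlgebraicGeometry TopologicalSpace IsLocalRing
open Literature.AlgebraicGeometry.Ramification Literature.AlgebraicGeometry.Resolution

namespace Summit.ResolutionOfSingularities.ResolutionOfSingularities.Theorems.WildQuotientResolution.KSGoingDown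

universe u v

variable {X' X T : Scheme.{u}} {π : X' ⟶ X} {I : X.IdealSheafData}

/-! ## Lifts to a blow-up are equivariant -/

/-- **Lifts to a blowing up are equivariant.** For a blowing up `π : X' → X` along `I`, an endomorphism
`s` of `X` preserving the centre (`I.comap s = I`) with a lift `s'` (`s' ≫ π = π ≫ s`), a morphism `φ : T → X'`
pulling the centre back to an effective Cartier divisor, and an endomorphism `a` of `T` over `s`
(`a ≫ φ ≫ π = φ ≫ π ≫ s`): `a ≫ φ = φ ≫ s'`. Both sides are morphisms `T → X'` over the same `T → X`, which
pulls `I` back to the effective Cartier divisor `(φ ≫ π)⁻¹ I` because `s⁻¹ I = I`; the universal property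
(✓`IsBlowup.hom_ext`) makes them equal. [folklore] -/
theorem comp_eq_comp_of_isBlowup (hπ : IsBlowup π I) {s : X ⟶ X} (hs : I.comap s = I) {s' : X' ⟶ X'}
    (hs' : s' ≫ π = π ≫ s) {φ : T ⟶ X'} (hφ : IsEffectiveCartier (I.comap (φ ≫ π))) {a : T ⟶ T}
    (ha : a ≫ φ ≫ π = φ ≫ π ≫ s) : a ≫ φ = φ ≫ s' := by
  have e : (a ≫ φ) ≫ π = (φ ≫ s') ≫ π := by
    rw [Category.assoc, ha, Category.assoc, hs']
  refine hπ.hom_ext ?_ e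
  rw [Category.assoc, ha, ← Category.assoc, Scheme.IdealSheafData.comap_comp, hs]
  exact hφ

/-- The same for automorphisms packaged as `Aut`: an action `σ'` on `X'` over an action `σ` on `X` preserving
the centre, and automorphisms `α_g` of `T` over `σ_g`. [folklore] -/
theorem aut_hom_comp_eq_of_isBlowup (hπ : IsBlowup π I) {G : Type v} [Group G] (σ : G →* Aut X)
    (σ' : G →* Aut X') (hσ' : ∀ g, (σ' g).hom ≫ π = π ≫ (σ g).hom) (hI : ∀ g, I.comap (σ g).hom = I)
    {φ : T ⟶ X'} (hφ : IsEffectiveCartier (I.comap (φ ≫ π))) {a : G → (T ⟶ T)}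
    (ha : ∀ g, a g ≫ φ ≫ π = φ ≫ π ≫ (σ g).hom) (g : G) : a g ≫ φ = φ ≫ (σ' g).hom :=
  comp_eq_comp_of_isBlowup hπ (hI g) (hσ' g) hφ (ha g)

/-! ## Inertia at the image of a fixed field-valued point -/

/-- **Inertia at the image of a fixed field-valued point.** Let `σ'` act on `X'` and let `φ : T → X'`.
If a field-valued point `p : Spec K → T` is fixed by endomorphisms `a_g` of `T` (`p ≫ a_g = p`) that `φ`
intertwines with `σ'_g` (`a_g ≫ φ = φ ≫ σ'_g`), then every `g` lies in the inertia group of `σ'` at the point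
of `X'` under `p ≫ φ` (the inertia group is the stabiliser of any field-valued point localised there,
✓`mem_inertiaSubgroup_iff_comp_eq`). [folklore] -/
theorem mem_inertiaSubgroup_of_fixed_fieldPoint {G : Type u} [Group G] (σ' : G →* Aut X')
    {K : Type u} [Field K] (p : Spec (.of K) ⟶ T) (φ : T ⟶ X') {a : G → (T ⟶ T)}
    (hp : ∀ g, p ≫ a g = p) (ha : ∀ g, a g ≫ φ = φ ≫ (σ' g).hom) (g : G) :
    g ∈ inertiaSubgroup σ' ((p ≫ φ) (closedPoint K)) := by
  refine (mem_inertiaSubgroup_iff_comp_eq σ' (p ≫ φ) g).mpr ?_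
  rw [Category.assoc, ← ha g, ← Category.assoc, hp g]

/-- **The Kollár–Szabó mechanism on a blow-up**: for a blowing up `π : X' → X` along a centre `I` preserved by
an action `σ` (`(σ g)⁻¹ I = I`), an action `σ'` on `X'` over `σ`, a morphism `φ : T → X'` pulling the centre back
to an effective Cartier divisor, endomorphisms `a_g` of `T` over `σ_g` (through `φ ≫ π`), and a field-valued
point `p` of `T` fixed by the `a_g`: every `g` is in the inertia group of `σ'` at `(p ≫ φ)(closed point)`.
[folklore] -/
theorem mem_inertiaSubgroup_of_isBlowup_of_fixed_fieldPoint (hπ : IsBlowup π I) {G : Type u} [Group G]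
    (σ : G →* Aut X) (σ' : G →* Aut X') (hσ' : ∀ g, (σ' g).hom ≫ π = π ≫ (σ g).hom)
    (hI : ∀ g, I.comap (σ g).hom = I) {φ : T ⟶ X'} (hφ : IsEffectiveCartier (I.comap (φ ≫ π)))
    {a : G → (T ⟶ T)} (ha : ∀ g, a g ≫ φ ≫ π = φ ≫ π ≫ (σ g).hom)
    {K : Type u} [Field K] (p : Spec (.of K) ⟶ T) (hp : ∀ g, p ≫ a g = p) (g : G) :
    g ∈ inertiaSubgroup σ' ((p ≫ φ) (closedPoint K)) :=
  mem_inertiaSubgroup_of_fixed_fieldPoint σ' p φ hp (aut_hom_comp_eq_of_isBlowup hπ σ σ' hσ' hI hφ ha) g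

/-- The same for the LIFTED action ✓`IsBlowup.liftAction` (whose equivariance `σ'_g ≫ π = π ≫ σ_g` is
✓`IsBlowup.liftAction_hom_comp`). [folklore] -/
theorem mem_inertiaSubgroup_liftAction_of_fixed_fieldPoint (hπ : IsBlowup π I) {G : Type u} [Group G]
    (σ : G →* Aut X) (hI : ∀ g, I.comap (σ g).hom = I) {φ : T ⟶ X'}
    (hφ : IsEffectiveCartier (I.comap (φ ≫ π))) {a : G → (T ⟶ T)}
    (ha : ∀ g, a g ≫ φ ≫ π = φ ≫ π ≫ (σ g).hom)
    {K : Type u} [Field K] (p : Spec (.of K) ⟶ T) (hp : ∀ g, p ≫ a g = p) (g : G) :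
    g ∈ inertiaSubgroup (hπ.liftAction σ hI) ((p ≫ φ) (closedPoint K)) :=
  mem_inertiaSubgroup_of_isBlowup_of_fixed_fieldPoint hπ σ (hπ.liftAction σ hI)
    (hπ.liftAction_hom_comp σ hI) hI hφ ha p hp g

/-- Bookkeeping: the point of `X'` under `p ≫ φ` lies over the point of `X` under `p ≫ φ ≫ π`. [folklore] -/
theorem comp_apply_closedPoint {K : Type u} [Field K] (p : Spec (.of K) ⟶ T) (φ : T ⟶ X') :
    π ((p ≫ φ) (closedPoint K)) = (p ≫ φ ≫ π) (closedPoint K) := by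
  simp only [Scheme.Hom.comp_base, TopCat.coe_comp, Function.comp_apply]

end Summit.ResolutionOfSingularities.ResolutionOfSingularities.Theorems.WildQuotientResolution.KSGoingDown

end
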